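import Literature.NumberTheory.EllipticCurves.XCubeSub8XSqAddXRankZero
import Literature.NumberTheory.EllipticCurves.XCubeSub8XSqAddXSelmer
import HarnessLib

/-!
# A finite, non-trivial `2`-primary Tate–Shafarevich group: `X : y² = x³ − 8x² + x` has rank `0`,
# `t_2(X) = corank_{ℤ₂} Ш(X/ℚ)[2^∞] = 0` and `#Ш(X/ℚ)[φ] = 4` (descent via `2`-isogeny inside the isogeny class)

Topic `NumberTheory/EllipticCurves`. Third of three files (`XCubeSub8XSqAddXRankZero`: §0–§2; `XCubeSub8XSqAddXSelmer`: §3;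
this file: §4–§5).

Topic `NumberTheory/EllipticCurves`. The method is Silverman, *AEC*, X.4.9 / X.4.2(a) (descent via
two-isogeny, the exact sequence `0 → E'(ℚ)/φE(ℚ) → S^{(φ)}(E/ℚ) → Ш(E/ℚ)[φ] → 0`, counted in the tree as
`2^{dim₂ S'(a,b)} = #ᾱ(E'(ℚ)) · #(Ш(E_{a,b}/ℚ) ∩ im Ξ)`, `TwoIsogenySelmerGroupSha`) and Prop. X.6.5(b)
(`Ш ≠ 0` from everywhere-locally-soluble homogeneous spaces without rational points), applied to the
isogeny class of the curve with full rational `2`-torsion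

  `X' : y² = x(x + 6)(x + 10) = x³ + 16x² + 60x`   (`= X.twoIsogenyCodomain`),

whose three `2`-isogenous quotients are `X = X'/⟨(0,0)⟩ ≅ [0, −8, 0, 1, 0]` (the curve of the title,
`Δ(X) = 960`, `j(X) = 244³/15`), `X'/⟨(−6,0)⟩` and `X'/⟨(−10,0)⟩`.

* §1 On the model `Y = [0, −2, 0, −24, 0] : y² = x(x − 6)(x + 4)` of `X'` (the point `(−6, 0)` moved to
  the origin) the descent via the `2`-isogeny with kernel `(0,0)` is SHARP at rank `0`:
  `S(−2, −24) ⊆ {±1, ±6}` (the other classes die modulo `5`), `S'(−2,−24) = S(4, 100) ⊆ {1}` (classes die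
  modulo `3`, `16`, `128`), so `rank Y(ℚ) = 0`, `Ш(Y/ℚ)[2] = 0`, `t_2(Y) = 0` (tree: `XCubeAddDXSharpRankSha`).
* §2 `X ~ Y` over `ℚ` (Vélu's `2`-isogeny `X → X'` of the tree and the translation `X' ≅ Y`), hence
  **`rank X(ℚ) = 0`** and **`t_2(X) = 0`** (`corank_{ℤ_p} Ш[p^∞]` and the rank are isogeny invariants, tree
  theorems `IsIsogenous.mordellWeilRank_eq`, `IsIsogenous.shaCorank_eq`).
* §3 The descent via `X → X'` is NOT sharp: all sixteen classes `± d`, `d ∣ 30`, of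
  `S'(−8, 1) = S(16, 60)` (homogeneous spaces `w² = d u⁴ + 16 u²z² + (60/d) z⁴`) are everywhere locally
  soluble — nine of them are exhibited with explicit local points at `∞, 2, 3, 5` and good reduction at
  `p ≥ 7` (Bhargava–Shankar / Hensel, tree `isSoluble_padic_of_not_dvd_disc`), which forces
  `dim₂ S(16, 60) = 4` since the order is a power of two `≤ 16`.
* §4 Only the four classes `1, 15, −6, −10` come from `X'(ℚ)` (`#α(X(ℚ))·#ᾱ(X'(ℚ)) = 2^{rank+2} = 4`), so
  **`#(Ш(X/ℚ) ∩ im Ξ) = 16/4 = 4`**: `Ш(X/ℚ)[φ] ≅ (ℤ/2ℤ)²` is realised by the twelve soluble-everywhere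
  quartics without a rational point (e.g. `w² = −u⁴ + 16u²z² − 60z⁴`).
* §5 Consequences: `Ш(X/ℚ) ≠ 0`, `Ш(X/ℚ)[2] ≠ 0`, while `Ш(X/ℚ)[2^∞]` is FINITE (`t_2(X) = 0`) — a finite
  non-trivial primary component of a Tate–Shafarevich group, certified unconditionally; `Ш[2]` is not an
  isogeny invariant (`Ш(Y)[2] = 0`, `X ~ Y`), whereas `t_2` is; `corank_{ℤ₂} Sel_{2^∞}(X/ℚ) = 0 = rank`.

Everything is re-verified by the kernel; the descent data (obstruction moduli, local points) were found by
a plain search. Theorems only; no definitions, no named facts.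

## References

* [SilvermanAEC2009] J. H. Silverman, *The Arithmetic of Elliptic Curves*, 2nd ed., GTM 106: Prop. X.4.9,
  Example X.4.10, Thm. X.4.2(a), Prop. X.4.7, Prop. X.6.5(b) (the method `Ш[φ] ≠ 0` from locally trivial
  homogeneous spaces), III.4/III.6 (isogenies).
* [SilvermanTate2015] J. H. Silverman, J. Tate, *Rational Points on Elliptic Curves*, §3.5–§3.6
  (`2^r = #α(Γ)·#ᾱ(Γ̄)/4`).
* [BhargavaShankarAnnals2015] M. Bhargava, A. Shankar, Ann. of Math. 181 (2015), Prop. 5.13 (good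
  reduction implies local solubility of binary quartics).
* [Greenberg1999LNM] R. Greenberg, LNM 1716 (1999), §1 (coranks under isogeny).
-/


noncomputable section

open scoped Classical

namespace Literature.NumberTheory.EllipticCurves

namespace XCubeSub8XSqAddX

open _root_.WeierstrassCurve _root_.WeierstrassCurve.Affine

/-- `b(a² − 4b) ≠ 0` for `(a, b) = (16, 60)`. [cite: SilvermanAEC2009, Prop. X.4.9] -/
private theorem hab' : (60 : ℤ) * ((16 : ℤ) ^ 2 - 4 * 60) ≠ 0 := by norm_num

/-- Squarefree integer dividing data: squarefreeness of a (small) integer from the factorisation of its absolute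
value. [folklore] -/
private theorem squarefree_int_of_natAbs' {d : ℤ} {n : ℕ} (h : d.natAbs = n) (hn : n ≠ 0)
    (hnd : n.primeFactorsList.Nodup) : Squarefree d :=
  Int.squarefree_natAbs.mp (h ▸ (Nat.squarefree_iff_nodup_primeFactorsList hn).mpr hnd)

/-! ## 4. `#ᾱ(X'(ℚ)) = 4` and `#(Ш(X/ℚ) ∩ im Ξ) = 4` -/

/-- Squarefree integers with the same square class in `ℚ*/ℚ*²` are equal. [cite: SilvermanTate2015, §3.5] -/
private theorem eq_of_sqClass_intCast_eq {d₁ d₂ : ℤ} (h₁ : Squarefree d₁) (h₂ : Squarefree d₂)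
    (he : sqClass (d₁ : ℚ) = sqClass (d₂ : ℚ)) : d₁ = d₂ := by
  have h0₁ : (d₁ : ℚ) ≠ 0 := by exact_mod_cast h₁.ne_zero
  have h0₂ : (d₂ : ℚ) ≠ 0 := by exact_mod_cast h₂.ne_zero
  have h1 : sqClass ((d₁ : ℚ) * d₂) = 1 := by rw [sqClass_mul h0₁ h0₂, he, SqUnits.mul_self]
  obtain ⟨u, hu⟩ := (sqClass_eq_one_iff (mul_ne_zero h0₁ h0₂)).mp h1
  obtain ⟨m, hm⟩ : IsSquare (d₁ * d₂) := by
    rw [← Rat.isSquare_intCast_iff]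
    exact ⟨u, by push_cast; rw [hu, pow_two]⟩
  exact eq_of_squarefree_of_mul_eq_sq h₁ h₂ (m := m) (by rw [hm, pow_two])

/-- `[x t²] = [x]` in `ℚ*/ℚ*²`. [cite: SilvermanTate2015, §3.5] -/
private theorem sqClass_mul_sq' {x t : ℚ} (hx : x ≠ 0) (ht : t ≠ 0) : sqClass (x * t ^ 2) = sqClass x := by
  rw [sqClass_mul hx (pow_ne_zero 2 ht), sqClass_sq, mul_one]

/-- A rational solution of `y² = x³ + ax² + bx` is a nonsingular point of `E_{a,b}`. [cite: SilvermanTate2015, §3.5] -/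
private theorem nonsingular_of_eq' {a b x y : ℚ} [(⟨0, a, 0, b, 0⟩ : WeierstrassCurve ℚ).IsElliptic]
    (hy : y ^ 2 = x ^ 3 + a * x ^ 2 + b * x) : (⟨0, a, 0, b, 0⟩ : WeierstrassCurve ℚ).toAffine.Nonsingular x y := by
  refine Affine.equation_iff_nonsingular.mp ?_
  rw [Affine.equation_iff]
  show y ^ 2 + 0 * x * y + 0 * y = x ^ 3 + a * x ^ 2 + b * x + 0
  linear_combination hy

/-- A rational point `(x, y)`, `x ≠ 0`, of `E_{a,b}` puts `[x]` into `α(E_{a,b}(ℚ))`. [cite: SilvermanTate2015, §3.5] -/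
private theorem sqClass_mem_range_of_eq' {a b x y : ℚ} [(⟨0, a, 0, b, 0⟩ : WeierstrassCurve ℚ).IsElliptic]
    (hy : y ^ 2 = x ^ 3 + a * x ^ 2 + b * x) (hx : x ≠ 0) :
    sqClass x ∈ Set.range (⟨0, a, 0, b, 0⟩ : WeierstrassCurve ℚ).xSqClass :=
  ⟨.some x y (nonsingular_of_eq' hy), xSqClass_some_of_ne_zero _ hx⟩

/-- **`#ᾱ(X'(ℚ)) ≥ 4`**: the classes `[1]`, `[60] = [15]`, `[−6]`, `[−10]` of `O` and the three points of
order `2` of `X' : y² = x(x + 6)(x + 10)`. [cite: SilvermanTate2015, §3.5–§3.6] -/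
theorem four_le_natCard_range_xSqClass_X' :
    (Set.range (⟨0, 16, 0, 60, 0⟩ : WeierstrassCurve ℚ).xSqClass).Finite ∧
      4 ≤ Nat.card (Set.range (⟨0, 16, 0, 60, 0⟩ : WeierstrassCurve ℚ).xSqClass) := by
  haveI := isElliptic_X'
  set W := (⟨0, 16, 0, 60, 0⟩ : WeierstrassCurve ℚ) with hW
  have hfin : (Set.range W.xSqClass).Finite := by
    have h := (natCard_range_xSqClass_le (a := 16) (b := 60) hab').1
    have e : (⟨0, ((16 : ℤ) : ℚ), 0, ((60 : ℤ) : ℚ), 0⟩ : WeierstrassCurve ℚ) = W := by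
      rw [hW]; ext <;> push_cast <;> ring
    rw [e] at h
    exact h
  refine ⟨hfin, ?_⟩
  have hs1 : sqClass (((1 : ℤ)) : ℚ) ∈ Set.range W.xSqClass := by
    refine ⟨0, ?_⟩
    rw [xSqClass_zero, Int.cast_one]
    exact ((sqClass_eq_one_iff one_ne_zero).mpr ⟨1, by norm_num⟩).symm
  have hs15 : sqClass (((15 : ℤ)) : ℚ) ∈ Set.range W.xSqClass := by
    refine ⟨W.twoTorsionPoint, ?_⟩
    rw [xSqClass_twoTorsionPoint]
    show sqClass (60 : ℚ) = _
    rw [show (60 : ℚ) = 15 * 2 ^ 2 by norm_num, sqClass_mul_sq' (by norm_num) (by norm_num)]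
    push_cast
    rfl
  have hsm6 : sqClass (((-6 : ℤ)) : ℚ) ∈ Set.range W.xSqClass := by
    have h := sqClass_mem_range_of_eq' (a := 16) (b := 60) (x := -6) (y := 0) (by norm_num) (by norm_num)
    rwa [show (-6 : ℚ) = ((-6 : ℤ) : ℚ) by norm_num] at h
  have hsm10 : sqClass (((-10 : ℤ)) : ℚ) ∈ Set.range W.xSqClass := by
    have h := sqClass_mem_range_of_eq' (a := 16) (b := 60) (x := -10) (y := 0) (by norm_num) (by norm_num)
    rwa [show (-10 : ℚ) = ((-10 : ℤ) : ℚ) by norm_num] at h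
  have hsqf : ∀ d ∈ ({1, 15, -6, -10} : Finset ℤ), Squarefree d := by
    intro d hd
    simp only [Finset.mem_insert, Finset.mem_singleton] at hd
    rcases hd with rfl | rfl | rfl | rfl
    · exact squarefree_int_of_natAbs' (n := 1) rfl one_ne_zero (by simp)
    · exact squarefree_int_of_natAbs' (n := 15) rfl (by norm_num) (by simp)
    · exact squarefree_int_of_natAbs' (n := 6) rfl (by norm_num) (by simp)
    · exact squarefree_int_of_natAbs' (n := 10) rfl (by norm_num) (by simp)
  have hsub : (↑(({1, 15, -6, -10} : Finset ℤ).image fun d : ℤ => sqClass (d : ℚ)) :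
      Set (SqUnits ℚ)) ⊆ Set.range W.xSqClass := by
    intro c hc
    obtain ⟨d, hd, rfl⟩ := Finset.mem_image.mp (Finset.mem_coe.mp hc)
    simp only [Finset.mem_insert, Finset.mem_singleton] at hd
    rcases hd with rfl | rfl | rfl | rfl
    · exact hs1
    · exact hs15
    · exact hsm6
    · exact hsm10
  have hcard : (({1, 15, -6, -10} : Finset ℤ).image fun d : ℤ => sqClass (d : ℚ)).card = 4 := by
    rw [Finset.card_image_of_injOn (fun d₁ h₁ d₂ h₂ he =>
      eq_of_sqClass_intCast_eq (hsqf d₁ h₁) (hsqf d₂ h₂) he)]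
    rfl
  calc 4 = (↑(({1, 15, -6, -10} : Finset ℤ).image fun d : ℤ => sqClass (d : ℚ)) :
        Set (SqUnits ℚ)).ncard := by rw [Set.ncard_coe_finset, hcard]
    _ ≤ (Set.range W.xSqClass).ncard := Set.ncard_le_ncard hsub hfin
    _ = Nat.card (Set.range W.xSqClass) := (Nat.card_coe_set_eq _).symm

/-- **`#ᾱ(X'(ℚ)) = 4` and `#α(X(ℚ)) = 1`**: `#α(X(ℚ))·#ᾱ(X'(ℚ)) = 2^{rank X(ℚ) + 2} = 4` (Silverman–Tate,
tree `natCard_range_xSqClass_mul`) with `#ᾱ ≥ 4`. [cite: SilvermanTate2015, §3.6 (2^r = #α(Γ)·#ᾱ(Γ̄)/4)] -/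
theorem natCard_range_xSqClass_X'_eq_four :
    Nat.card (Set.range (⟨0, 16, 0, 60, 0⟩ : WeierstrassCurve ℚ).xSqClass) = 4 ∧
      Nat.card (Set.range (⟨0, -8, 0, 1, 0⟩ : WeierstrassCurve ℚ).xSqClass) = 1 := by
  haveI := isElliptic_X
  have hmul := (⟨0, -8, 0, 1, 0⟩ : WeierstrassCurve ℚ).natCard_range_xSqClass_mul
  rw [twoIsogenyCodomain_X, mordellWeilRank_X, zero_add] at hmul
  have h4 := four_le_natCard_range_xSqClass_X'.2
  have hfinX : (Set.range (⟨0, -8, 0, 1, 0⟩ : WeierstrassCurve ℚ).xSqClass).Finite := by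
    have h := (natCard_range_xSqClass_le (a := -8) (b := 1) habX).1
    rwa [lit_X] at h
  have h1 : 1 ≤ Nat.card (Set.range (⟨0, -8, 0, 1, 0⟩ : WeierstrassCurve ℚ).xSqClass) := by
    haveI := hfinX.to_subtype
    exact Nat.card_pos (α := Set.range (⟨0, -8, 0, 1, 0⟩ : WeierstrassCurve ℚ).xSqClass)
  set A := Nat.card (Set.range (⟨0, -8, 0, 1, 0⟩ : WeierstrassCurve ℚ).xSqClass) with hA
  set B := Nat.card (Set.range (⟨0, 16, 0, 60, 0⟩ : WeierstrassCurve ℚ).xSqClass) with hB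
  have hmul4 : A * B = 4 := by rw [hmul]; norm_num
  have hBle : B ≤ 4 := by
    calc B = 1 * B := (one_mul B).symm
      _ ≤ A * B := Nat.mul_le_mul_right B h1
      _ = 4 := hmul4
  have hB4 : B = 4 := le_antisymm hBle h4
  refine ⟨hB4, ?_⟩
  rw [hB4] at hmul4
  omega

/-- Transport of `#(Ш(X) ∩ im Ξ_X)` along an equality of curve literals (the instances are propositions).
[folklore] -/
private theorem natCard_sha_inf_range_congr {X Y : WeierstrassCurve ℚ}
    [X.IsTwoTorsionNF] [X.IsElliptic] [Y.IsTwoTorsionNF] [Y.IsElliptic] (h : X = Y) :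
    Nat.card ↥(X.sha ⊓ X.twoIsogenyTorsorHom.range) = Nat.card ↥(Y.sha ⊓ Y.twoIsogenyTorsorHom.range) := by
  subst h
  rfl

/-- **`#(Ш(X/ℚ) ∩ im Ξ) = 4`: `Ш(X/ℚ)[φ] ≅ (ℤ/2ℤ)²`** for `X : y² = x³ − 8x² + x` and its `2`-isogeny
`φ : X → X' = X/⟨(0,0)⟩` — Silverman's count `2^{dim₂ S^{(φ)}(X/ℚ)} = #ᾱ(X'(ℚ)) · #Ш(X/ℚ)[φ]`
(AEC X.4.2(a), tree `two_pow_twoIsogenySelmerRank'_eq_natCard_mul`) with `dim₂ = 4` and `#ᾱ = 4`: the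
twelve everywhere-locally-soluble quartics `w² = du⁴ + 16u²z² + (60/d)z⁴`, `d ∉ {1, 15, −6, −10}`, have no
rational point and represent the three non-zero classes. [cite: SilvermanAEC2009, Prop. X.6.5(b) (the method) with Thm. X.4.2(a)] -/
theorem natCard_sha_inf_range_eq_four [hE : (⟨0, -8, 0, 1, 0⟩ : WeierstrassCurve ℚ).IsElliptic] :
    Nat.card ↥((⟨0, -8, 0, 1, 0⟩ : WeierstrassCurve ℚ).sha ⊓
      (⟨0, -8, 0, 1, 0⟩ : WeierstrassCurve ℚ).twoIsogenyTorsorHom.range) = 4 := by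
  haveI hE' : (⟨0, ((-8 : ℤ) : ℚ), 0, ((1 : ℤ) : ℚ), 0⟩ : WeierstrassCurve ℚ).IsElliptic := by
    rw [lit_X]; exact hE
  have key := two_pow_twoIsogenySelmerRank'_eq_natCard_mul (a := -8) (b := 1) habX
  rw [twoIsogenySelmerRank'_X, lit_X', natCard_range_xSqClass_X'_eq_four.1,
    natCard_sha_inf_range_congr lit_X] at key
  omega

/-! ## 5. Consequences: `Ш(X/ℚ) ≠ 0`, `Ш(X/ℚ)[2] ≠ 0`, `Ш(X/ℚ)[2^∞]` finite and non-trivial -/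

/-- **`Ш(X/ℚ) ≠ 0`** for `X : y² = x³ − 8x² + x`. [cite: SilvermanAEC2009, Prop. X.6.5(b) (the method)] -/
theorem sha_X_ne_bot : (⟨0, -8, 0, 1, 0⟩ : WeierstrassCurve ℚ).sha ≠ ⊥ := by
  haveI := isElliptic_X
  intro h
  have h4 := natCard_sha_inf_range_eq_four
  rw [h, bot_inf_eq, AddSubgroup.card_bot] at h4
  norm_num at h4

/-- **`Ш(X/ℚ)[2] ≠ 0`**: there is a non-zero class of order `2` in `Ш(X/ℚ)` (a class of a homogeneous space
`C_d`, killed by `2`). [cite: SilvermanAEC2009, Prop. X.6.5(b) (the method) with Thm. X.4.2(a)] -/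
theorem exists_mem_sha_X_ne_zero_two_smul :
    ∃ c ∈ (⟨0, -8, 0, 1, 0⟩ : WeierstrassCurve ℚ).sha, c ≠ 0 ∧ 2 • c = 0 := by
  haveI := isElliptic_X
  set G := (⟨0, -8, 0, 1, 0⟩ : WeierstrassCurve ℚ).sha ⊓
    (⟨0, -8, 0, 1, 0⟩ : WeierstrassCurve ℚ).twoIsogenyTorsorHom.range with hG
  have h4 : Nat.card ↥G = 4 := natCard_sha_inf_range_eq_four
  haveI : Finite ↥G := Nat.finite_of_card_ne_zero (by rw [h4]; norm_num)
  have hnt : Nontrivial ↥G := Finite.one_lt_card_iff_nontrivial.mp (by rw [h4]; norm_num)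
  obtain ⟨⟨c, hc⟩, hne⟩ := exists_ne (0 : ↥G)
  have hc' := hc
  rw [hG, AddSubgroup.mem_inf] at hc'
  obtain ⟨hsha, ⟨x, hx⟩⟩ := hc'
  refine ⟨c, hsha, fun h0 => hne (Subtype.ext h0), ?_⟩
  rw [← hx]
  exact two_nsmul_twoIsogenyTorsorHom _ x

/-- **The first descent at `2` does not decide `X`**: `Ш(X/ℚ)[2] = 0` FAILS. [cite: SilvermanAEC2009, Prop. X.6.5(b) (the method)] -/
theorem not_forall_mem_sha_X_two_smul_eq_zero :
    ¬ ∀ c ∈ (⟨0, -8, 0, 1, 0⟩ : WeierstrassCurve ℚ).sha, 2 • c = 0 → c = 0 := by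
  intro h
  obtain ⟨c, hc, hne, h2⟩ := exists_mem_sha_X_ne_zero_two_smul
  exact hne (h c hc h2)

/-- **`Ш(X/ℚ)[2^∞] ≠ 0`** (it contains the classes of order `2`). [cite: SilvermanAEC2009, Prop. X.6.5(b) (the method)] -/
theorem primaryComponent_sha_X_two_ne_bot :
    AddCommGroup.primaryComponent (⟨0, -8, 0, 1, 0⟩ : WeierstrassCurve ℚ).sha 2 ≠ ⊥ := by
  obtain ⟨c, hc, hne, h2⟩ := exists_mem_sha_X_ne_zero_two_smul
  intro h
  have hmem : (⟨c, hc⟩ : ↥(⟨0, -8, 0, 1, 0⟩ : WeierstrassCurve ℚ).sha) ∈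
      AddCommGroup.primaryComponent (⟨0, -8, 0, 1, 0⟩ : WeierstrassCurve ℚ).sha 2 := by
    refine ⟨1, ?_⟩
    simp only [pow_one]
    exact Subtype.ext (by simpa using h2)
  rw [h, AddSubgroup.mem_bot] at hmem
  exact hne (congrArg Subtype.val hmem)

/-- **A finite non-trivial Tate–Shafarevich primary component**: `Ш(X/ℚ)[2^∞]` is finite (`t_2(X) = 0`, by
the sharp descent on the isogenous `Y`) and non-zero (`Ш(X/ℚ)[φ] ≅ (ℤ/2ℤ)²`), for `X : y² = x³ − 8x² + x`.
[cite: SilvermanAEC2009, Prop. X.6.5(b) (the method)] [cite: Greenberg1999LNM, §1 pp. 54–57] -/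
theorem finite_and_ne_bot_primaryComponent_sha_X_two :
    Finite (AddCommGroup.primaryComponent (⟨0, -8, 0, 1, 0⟩ : WeierstrassCurve ℚ).sha 2) ∧
      AddCommGroup.primaryComponent (⟨0, -8, 0, 1, 0⟩ : WeierstrassCurve ℚ).sha 2 ≠ ⊥ :=
  ⟨finite_primaryComponent_sha_X_two, primaryComponent_sha_X_two_ne_bot⟩

/-- **`Ш[2]` is not an isogeny invariant** (Cassels): `X ~ Y` over `ℚ`, `Ш(Y/ℚ)[2] = 0`, `Ш(X/ℚ)[2] ≠ 0`
— while `t_2(X) = t_2(Y) = 0`. [cite: SilvermanAEC2009, Prop. X.6.5(b) (the method)] [cite: Greenberg1999LNM, §1 pp. 54–57] -/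
theorem sha_two_torsion_not_isogeny_invariant :
    IsIsogenous (⟨0, -8, 0, 1, 0⟩ : WeierstrassCurve ℚ) (⟨0, -2, 0, -24, 0⟩ : WeierstrassCurve ℚ) ∧
      (∀ c ∈ (⟨0, -2, 0, -24, 0⟩ : WeierstrassCurve ℚ).sha, 2 • c = 0 → c = 0) ∧
      (¬ ∀ c ∈ (⟨0, -8, 0, 1, 0⟩ : WeierstrassCurve ℚ).sha, 2 • c = 0 → c = 0) ∧
      (⟨0, -8, 0, 1, 0⟩ : WeierstrassCurve ℚ).shaCorank 2 = 0 ∧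
      (⟨0, -2, 0, -24, 0⟩ : WeierstrassCurve ℚ).shaCorank 2 = 0 :=
  ⟨isIsogenous_X_Y, forall_mem_sha_Y_two_smul_eq_zero, not_forall_mem_sha_X_two_smul_eq_zero,
    shaCorank_X_two, shaCorank_Y_two⟩

/-- **`corank_{ℤ₂} Sel_{2^∞}(X/ℚ) = 0 = rank X(ℚ)`** although `Ш(X/ℚ)[2] ≠ 0` (Greenberg's identity
`corank Sel_{p^∞} = rank + t_p`, tree theorem). [cite: Greenberg1999LNM, §1 pp. 54–57] -/
theorem selmerCorank_X_two : (⟨0, -8, 0, 1, 0⟩ : WeierstrassCurve ℚ).selmerCorank 2 = 0 := by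
  haveI := isElliptic_X
  haveI : Fact (Nat.Prime 2) := ⟨Nat.prime_two⟩
  rw [WeierstrassCurve.selmerCorank_eq_mordellWeilRank_add_holds, mordellWeilRank_X, shaCorank_X_two]

end XCubeSub8XSqAddX

end Literature.NumberTheory.EllipticCurves

end
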